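import Literature.MathematicalPhysics.QuantumFieldTheory.Balaban1983to89.B3GkZeroTorusSeparated
import Literature.MathematicalPhysics.QuantumFieldTheory.Balaban1983to89.B3Sect3Statements
import Literature.MathematicalPhysics.QuantumFieldTheory.Balaban1983to89.B3Sect1Statements

/-!
# `Balaban1983to89.B3Ineq31ZeroTorus` — T. Bałaban, *(Higgs)₂,₃ quantum fields in a finite volume. III. Renormalization*,
# Commun. Math. Phys. **88** (1983) 411–445 [Balaban1983Higgs3], (3.1) p. 432:
# `‖hG_k(Ω,B̃)h′‖_{1,α} ≤ O(1)e^{−δ₀dist(□(v),□(v′))}`, PROVED for the TORUS MODEL INSTANCE `A = B̃ = 0`, `Ω = T_η` (the paper's own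
# lattice `T_η`, `η = L^{−k}`), `h, h′` the unit-cube localizations of p. 420, `‖·‖_{1,α}` the printed norm (1.32) of the two-variable
# field `(x,x′) ↦ G_k(T_η,0;x,x′)` on `□(v) × □(v′)` — `Sect3Data.Ineq31 α δ₀ C` DISCHARGED for the concrete carrier `sect3ZeroTorus`,
# for each `0 ≤ α < 1`, uniformly in the volume `(m, K)` and the scale `1 ≤ k ≤ K`

statement-level skeleton of published theorems with citation tags; proofs where landed; nothing here is a claim about the Yang–Mills mass gap

PDF held: `paper:balaban1983-higgs-2-3-quantum-fields-finite-volume` (journal page = PDF page + 410); p. 420 [PDF 10] ((1.32), the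
localizations), p. 424 [PDF 14] ((2.5), (2.6)), p. 432 [PDF 22] ((3.1)) read in the OCR text (`p0010.txt`, `p0014.txt`, `p0022.txt`).

CITATION HEADER (lean-in-tree rule).  Part of the lit-balaban TYPED SKELETON (HOME `run/shared/lean/pub/lit-balaban/`), Phase 2:
SKELETON row **B3.Eq3.1** (`HOME/lit-balaban-r15/ROWS-B3.md`, fold owner r15; decl of record `B3Sect3Statements.Sect3Data.Ineq31`,
typed p239220 over the ABSTRACT carrier `Sect3Data`; head «typed · proved MODEL-INSTANCE member» with the box instance p256156 +
p256797); file 2 of 2 of the member «TORUS MODEL INSTANCE A = B̃ = 0, Ω = T_η» (file 1 = `B3GkZeroTorusSeparated`, p263724: the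
kernel estimates at separated arguments); TORUS TWIN of this seat's `B3Ineq31ZeroBox` (p256797); companion of `B3Ineq210ZeroTorus` /
`B3Ineq211ZeroTorus` / `B3Ineq212ZeroTorus` (rows B3.Eq2.6/2.10–2.12 on `T_η`), whose instance this is.

WHAT IS PRINTED.  (3.1) p. 432 [PDF 22]: *"Now if two vertices, v, v′ have localizations satisfying dist(□(v), □(v′)) ≥ 1, then we
consider every propagator corresponding to a line connecting these vertices as an external field also. Such a possibility is
assured by the following estimates ‖hG_k(Ω,B̃)h′‖_{1,α} ≤ O(1)e^{−δ₀dist(□(v),□(v′))}, (3.1) and similarly for the vector field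
propagator, h, h′ are localization functions."*  (1.32) p. 420 [PDF 10]: *"For a scalar field f of one variable we define
‖f‖_{1,α} = sup_x |f(x)| + sup_{x,μ} |(D^η_{B,μ}f)(x)| + sup_{x,x′,μ} |x − x′|^{−α}|U(B(Γ_{x,x′}))(D^η_{B,μ}f)(x′) − (D^η_{B,μ}f)(x)|, (1.32)
where Γ_{x,x′} is a shortest contour connecting x and x′. This definition extends in a natural way to functions of many
variables. For external vector fields we have the same definition, but with B = 0. The next thing we need is a further
localization in the vertices. For the vertices (1.6) and (1.7) we localize simply by representing Ω₁ as a sum of unit cubes of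
the [unit] lattice."*

WHAT IS REPRODUCED, and how (kind «model-instance», G.1 of `HOME/PHASE2-TARGETS.md`).  On Bałaban's CONCRETE scalar torus tower
`B1RG242Torus.tower P a msq` (volume `P = (d, L, m, K)`, finest torus `T^{(0)}`, `ε = L^{−K}`, `U ≡ 1`), at the scale `1 ≤ k ≤ K`, IN THE
PRINT'S UNITS FOR THE STEP `k`: the unit lattice `T_1^{(k)}` = the `k`-blocks `Site P k`, the fine lattice `T_η`, `η = L^{−k}` (`η|x−x′| =
|x−x′|_T/L^k`), the propagator kernel `G_k(T_η,0;x,x′) = (L^k)^d(L^kε)^{−2}·G^ε_k(x,x′)` (the `ε^d`-normalised kernel `ε^{−d}G^ε_k` of the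
companions rescaled from `T_ε` to `T_η`: a covariance of scaling dimension `2 − d`), `∂^η = L^k·`(forward difference).
* §1 the unit cubes `□(v) = {x ∈ T_η : ⌊x/L^k⌋ = v}`, `v ∈ T_1^{(k)}` (`B5Ineq137Torus.blk`), `dist(□(v),□(v′)) = max(|v − v′|_{T^{(k)}} − 1, 0)`
  (`cubeDistT`, sup torus distance of the closed unit cubes) and the SEPARATION of their points (`pow_mul_T_blk_le`:
  `L^k(|⌊x/L^k⌋ − ⌊x′/L^k⌋|_{T^{(k)}} − 1) + 1 ≤ |x − x′|_T`, coordinatewise through `circAbs(L^kN, L^kz) = L^k·circAbs(N, z)`; hence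
  `L^k·dist(□(v),□(v′)) ≤ |x − x′|_T`, `pow_mul_cubeDistT_le`).
* §2 the cube in coordinates (`⌊x_i/L^k⌋ = v_i`, points of one cube differ by `< L^k ≤ |T_ε|/2` in every coordinate, so their torus
  distance is the plain one) and a lattice PATH LEMMA on a cube of `T_η` (`path_le`, private): nearest-neighbour differences `≤ B`
  inside `□(v′)` give `|g(y₂) − g(y₁)| ≤ B·Σ_i|y₂ᵢ − y₁ᵢ| ≤ B·d·|y₂ − y₁|_T` (a staircase inside the cube, by `Site.shift`/`Site.unshift`).
* §3 the objects of (3.1): the two-variable field `kerF (x,x′) = G_k(T_η,0;x,x′)` on `T_η × T_η`; the localization domain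
  `sites v v′ = □(v) × □(v′)`; the product-lattice bonds `bonds v v′` in the `2d` directions (row bonds `(μ,(x,x′)) : (x,x′) → (x+e_μ,x′)`,
  column bonds `(ν,(x,x′)) : (x,x′) → (x,x′+e_ν)`, both ends in the domain) carrying `derivF = L^k·ΔF` (`U ≡ 1`); `normHGH α v v′` =
  the printed SUM form (1.32) `B3Sect1Statements.norm132` of `(kerF, derivF)` over `(sites, bonds)` with same-direction bond pairs
  admissible and the product sup-distance `pdist` in `η`-units; the CARRIER `sect3ZeroTorus P a msq k : Sect3Data` (`LocFn = T_1^{(k)}`,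
  `distCubes = cubeDistT`, `normHGH`; the (3.2)–(3.5) data NOT modelled: `RenClass′ = ∅`, nothing claimed); `ineq31_iff` (`Iff.rfl`).
* §4 the three parts of (1.32) from kernel clauses at separation `ρ = 1` in the rescaled form (`supPart_le`, `derivPart_le`,
  **`holderPart_le`**: for two same-direction bonds split the difference of derivatives at the intermediate bond — same
  differentiated variable → the Hölder clause; other variable → the path lemma inside the cube with steps bounded by the MIXED
  clause when `η|Δ| ≤ 1` (`t ≤ t^α`), twice the derivative sup when `η|Δ| > 1` (`1 ≤ t^α`)); §5 the unit conversion
  `ε`-normalisation ↔ `η`-normalisation (the scale factors `(L^kε)^{2−d}`, `(L^kε)^{1−d}`, `(L^kε)^{1−d−α}`, `(L^kε)^{−d}` of file 1 are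
  exactly absorbed) and **`ineq31_zeroTorus`**: `∀ α ∈ [0,1) ∃ δ₀ C > 0 ∀ volume (d, L fixed) ∀ 1 ≤ k ≤ K:
  (sect3ZeroTorus P a msq k).Ineq31 α δ₀ C`; §6 a non-vacuity witness.

HONEST SCOPE / DECLARED DIVERGENCES (F7).  (i) Only `A = B̃ = 0` (`U(B̃(Γ)) ≡ 1`, one component), `Ω = T_η` the WHOLE torus (B4 p. 572:
the periodic parallelepiped; not subsets, not `δG_k(Ω,Ω₂,B̃)` / (2.5)), torus sides `2L^{m+K}`, odd `L`, FIXED `a > 0`, `m² ≥ 0` (the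
companions' scope); only the SCALAR propagator `G_k` («similarly for the vector field propagator» not covered).  (ii) LOCALIZATION
FUNCTIONS: `h, h′` are the INDICATORS of two unit cubes `□(v), □(v′)` of `T_1^{(k)}` (p. 420, the localization of the scalar vertices);
the norm of the localized two-variable field is taken OVER ITS LOCALIZATION DOMAIN `□(v) × □(v′)` (sites and bonds inside it) — the
smooth partitions of unity used for vector legs / external fields are NOT modelled (as in the box twin).  (iii) «extends in a
natural way to functions of many variables» is READ as in the box twin: the same formula on the product lattice `T_η × T_η` — sup
over the domain, sup of the lattice derivatives in all `2d` directions, sup of the Hölder quotients over pairs of bonds with the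
SAME direction and distinct base points, the distance of base points being the sup of the two torus distances in `η`-units.
(iv) `dist(□(v),□(v′))` = sup torus distance of the closed unit cubes.  (v) UNITS: the print's, for the step `k` (`η = L^{−k}`,
`T_1^{(k)}` the unit lattice): kernel `(L^k)^d(L^kε)^{−2}G^ε_k`, derivatives `L^k·Δ`, distances `|·|_T/L^k`; at `k = K` (`L^Kε = 1`)
this is literally the companions' `ε^{−d}G^ε_K` on `T_ε`.  (vi) QUANTIFIERS/CONSTANTS: `∀ α ∈ [0,1) ∃ (δ₀, C)` depending on
`d, L, a, m², α`, uniform in `(m, K)`, `k ≤ K`, the cubes; NOT uniform in `α` (G-B3-11: the print's O(1) is at the paper's fixed `α`);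
existential.  (vii) ROUTE = the print's («assured by the following estimates» = the propagator bounds of [B4]/Props. I.2.1–I.2.3
behind (2.10)–(2.11)), through file 1's six clauses used BY NAME; no Literature fact minted (`cubeDistT`, `kerF`, `sites`, `bonds`,
`derivF`, `pdist`, `normHGH`, `sect3ZeroTorus` are concrete `def`s, the theorems are proved); standard axioms.  Value = kernel
certificate of a located by-reference step of B3 for the zero-background torus instance, NOT summit progress.
Unit `lit-balaban-p03-g5` (Phase-2 proof seat p03, gen 5); HOME `run/shared/lean/pub/lit-balaban/` (row B3.Eq3.1, FILED.md, STATUS.md).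
-/

namespace Literature.MathematicalPhysics.QuantumFieldTheory.Balaban1983to89.B3Ineq31ZeroTorus

open Finset Matrix B1RG242Torus B5Ineq137Torus
open B4TorusKernel.MultiPeriod (circAbs circAbs_nonneg circAbs_le_abs circAbs_of_centred)
open B3GkZeroTorusSeparated B3Sect3Statements
open B3Sect1Statements (norm132 norm132_nonneg)

noncomputable section

variable {P : Params}

/-! ## §1 The unit cubes `□(v)`, `v ∈ T_1^{(k)}`, of the fine torus `T_η` and their distance -/

/-- `dist(□(v), □(v′))` for the closed unit cubes of `T_1^{(k)}` over `v, v′` (sup torus distance): `max(|v − v′|_{T^{(k)}} − 1, 0)`.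
[cite: Balaban1983Higgs3, (3.1) p.432] -/
def cubeDistT (k : ℕ) (v v' : Site P k) : ℝ := max (T P k v v' - 1) 0

/-- `dist(□(v), □(v′)) ≥ 0`. [cite: Balaban1983Higgs3, (3.1) p.432] -/
theorem cubeDistT_nonneg (k : ℕ) (v v' : Site P k) : 0 ≤ cubeDistT k v v' := le_max_right _ _

/-- kernel: remainders modulo `b` differ by at most `b − 1`. [folklore] -/
private theorem abs_mod_sub_mod_le (a a' : ℕ) {b : ℕ} (hb : 0 < b) :
    |((a' % b : ℕ) : ℤ) - ((a % b : ℕ) : ℤ)| ≤ (b : ℤ) - 1 := by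
  have h1 : a % b < b := Nat.mod_lt _ hb
  have h2 : a' % b < b := Nat.mod_lt _ hb
  rw [abs_le]; constructor <;> omega

/-- **Points of two unit cubes are separated by the cube distance**: for fine sites `x, x′ ∈ T_η` with blocks `⌊x/L^k⌋, ⌊x′/L^k⌋ ∈ T_1^{(k)}`,
`L^k·(|⌊x/L^k⌋ − ⌊x′/L^k⌋|_{T^{(k)}} − 1) + 1 ≤ |x − x′|_T` (coordinatewise: `L^k·dist(z, N_kℤ) = dist(L^kz, N_0ℤ)` and the remainders are
`< L^k`). [cite: Balaban1983Higgs3, (3.1) p.432] -/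
theorem pow_mul_T_blk_le {k : ℕ} (hk : k ≤ P.m + P.K) (x x' : Site P 0) :
    (P.L : ℝ) ^ k * (T P k (blk P k x) (blk P k x') - 1) + 1 ≤ T P 0 x x' := by
  classical
  have hne : (univ : Finset (Fin P.d)).Nonempty := ⟨⟨0, P.hd⟩, mem_univ _⟩
  obtain ⟨i, -, hi⟩ := exists_mem_eq_sup _ hne (B4Sect5Torus.ccoord (Nv P k) (toT (blk P k x)) (toT (blk P k x')))
  set c : ℕ := B4Sect5Torus.ccoord (Nv P k) (toT (blk P k x)) (toT (blk P k x')) i with hc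
  have hTk : T P k (blk P k x) (blk P k x') = (c : ℝ) := by
    show ((univ.sup (B4Sect5Torus.ccoord (Nv P k) (toT (blk P k x)) (toT (blk P k x'))) : ℕ) : ℝ) = (c : ℝ)
    rw [hi]
  have hn := B4Sect5Torus.circAbs_le_tdist (Nv_pos P 0) (toT x) (toT x') i
  set b : ℕ := P.L ^ k with hb
  have hb0 : 0 < b := pow_pos P.L_pos k
  set n : ℤ := circAbs (Nv P 0 i) ((((toT x) i).val : ℤ) - (((toT x') i).val : ℤ)) with hndef
  have key : (b : ℤ) * (c : ℤ) ≤ n + ((b : ℤ) - 1) := by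
    have hcc : (c : ℤ) = circAbs (Nv P k i) ((((toT (blk P k x)) i).val : ℤ) - (((toT (blk P k x')) i).val : ℤ)) :=
      B4Sect5Torus.ccoord_cast (Nv_pos P k) _ _ i
    have ev : ((toT (blk P k x)) i).val = (x i).val / b := blk_val P hk x i
    have ev' : ((toT (blk P k x')) i).val = (x' i).val / b := blk_val P hk x' i
    have ex : ((toT x) i).val = (x i).val := rfl
    have ex' : ((toT x') i).val = (x' i).val := rfl
    have hN : Nv P 0 i = b * Nv P k i := (pow_mul_sitesPerDir P hk).symm
    have hdm : (b : ℤ) * ((((x i).val / b : ℕ)) : ℤ) + ((((x i).val % b : ℕ)) : ℤ) = ((x i).val : ℤ) := by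
      exact_mod_cast Nat.div_add_mod ((x i).val) b
    have hdm' : (b : ℤ) * ((((x' i).val / b : ℕ)) : ℤ) + ((((x' i).val % b : ℕ)) : ℤ) = ((x' i).val : ℤ) := by
      exact_mod_cast Nat.div_add_mod ((x' i).val) b
    have hz : (b : ℤ) * (((((x i).val / b : ℕ)) : ℤ) - ((((x' i).val / b : ℕ)) : ℤ))
        = (((x i).val : ℤ) - ((x' i).val : ℤ)) + (((((x' i).val % b : ℕ)) : ℤ) - ((((x i).val % b : ℕ)) : ℤ)) := by
      linear_combination hdm - hdm'
    have hmul := circAbs_mul_mul hb0 (Nv P k i) (((((x i).val / b : ℕ)) : ℤ) - ((((x' i).val / b : ℕ)) : ℤ))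
    have h1 := B4Sect5Torus.circAbs_add_le (Nv_pos P 0 i) (((x i).val : ℤ) - ((x' i).val : ℤ))
      (((((x' i).val % b : ℕ)) : ℤ) - ((((x i).val % b : ℕ)) : ℤ))
    have h2 := circAbs_le_abs (Nv_pos P 0 i) (((((x' i).val % b : ℕ)) : ℤ) - ((((x i).val % b : ℕ)) : ℤ))
    have h3 := abs_mod_sub_mod_le ((x i).val) ((x' i).val) hb0
    rw [hcc, ev, ev', ← hmul, ← hN, hz]
    rw [hndef, ex, ex']
    linarith
  have keyR : ((b : ℤ) : ℝ) * ((c : ℤ) : ℝ) ≤ (n : ℝ) + (((b : ℤ) : ℝ) - 1) := by exact_mod_cast key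
  have hbR : ((b : ℤ) : ℝ) = (P.L : ℝ) ^ k := by simp [hb]
  have hn' : (n : ℝ) ≤ T P 0 x x' := hn
  rw [hTk]
  rw [hbR] at keyR
  push_cast at keyR
  linarith

/-- For fine sites `x ∈ □(v)`, `x′ ∈ □(v′)`: `L^k·dist(□(v), □(v′)) ≤ |x − x′|_T`, i.e. `η|x − x′|_T ≥ dist(□(v),□(v′))`.
[cite: Balaban1983Higgs3, (3.1) p.432] -/
theorem pow_mul_cubeDistT_le {k : ℕ} (hk : k ≤ P.m + P.K) {x x' : Site P 0} {v v' : Site P k} (hx : blk P k x = v)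
    (hx' : blk P k x' = v') : (P.L : ℝ) ^ k * cubeDistT k v v' ≤ T P 0 x x' := by
  unfold cubeDistT
  rcases le_total (T P k v v' - 1) 0 with h | h
  · rw [max_eq_right h, mul_zero]; exact T_nonneg P 0 x x'
  · rw [max_eq_left h, ← hx, ← hx']
    linarith [pow_mul_T_blk_le hk x x']

/-- kernel: points of two cubes at distance `≥ 1` are separated: `L^k ≤ |x − x′|_T` and `dist(□(v),□(v′)) ≤ |x − x′|_T/L^k`.
[cite: Balaban1983Higgs3, (3.1) p.432] -/
theorem sep_of_blk {k : ℕ} (hk : k ≤ P.m + P.K) {x x' : Site P 0} {v v' : Site P k} (hx : blk P k x = v)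
    (hx' : blk P k x' = v') (hD : 1 ≤ cubeDistT k v v') :
    1 * (P.L : ℝ) ^ k ≤ T P 0 x x' ∧ cubeDistT k v v' ≤ T P 0 x x' / (P.L : ℝ) ^ k := by
  have hb : (0 : ℝ) < (P.L : ℝ) ^ k := pow_pos P.cast_L_pos k
  have h := pow_mul_cubeDistT_le hk hx hx'
  refine ⟨?_, ?_⟩
  · calc 1 * (P.L : ℝ) ^ k = (P.L : ℝ) ^ k * 1 := by ring
      _ ≤ (P.L : ℝ) ^ k * cubeDistT k v v' := mul_le_mul_of_nonneg_left hD hb.le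
      _ ≤ T P 0 x x' := h
  · rw [le_div_iff₀ hb]; linarith

/-! ## §2 A cube in coordinates and the path lemma inside a cube of `T_η` -/

/-- kernel: the cube condition coordinatewise: `⌊y_i/L^k⌋ = v′_i`. [folklore] -/
private theorem blk_eq_iff {k : ℕ} (hk : k ≤ P.m + P.K) (y : Site P 0) (v' : Site P k) :
    blk P k y = v' ↔ ∀ i, (y i).val / P.L ^ k = (v' i).val := by
  constructor
  · intro h i; rw [← h, blk_val P hk]
  · intro h; funext i; apply ZMod.val_injective; rw [blk_val P hk]; exact h i

/-- kernel: the coordinates of a point of `□(v′)` lie in `[L^kv′_i, L^kv′_i + L^k)`. [folklore] -/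
private theorem cube_bounds {k : ℕ} (hk : k ≤ P.m + P.K) {y : Site P 0} {v' : Site P k} (h : blk P k y = v') (i : Fin P.d) :
    P.L ^ k * (v' i).val ≤ (y i).val ∧ (y i).val < P.L ^ k * (v' i).val + P.L ^ k := by
  have e := (blk_eq_iff hk y v').1 h i
  constructor
  · rw [← e]; exact Nat.mul_div_le _ _
  · rw [← e, ← Nat.mul_succ]; exact Nat.lt_mul_div_succ _ (pow_pos P.L_pos k)

/-- kernel: integer division pinned by bounds. [folklore] -/
private theorem div_eq_of_bounds {a b q : ℕ} (hb : 0 < b) (lo : b * q ≤ a) (hi : a < b * q + b) : a / b = q := by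
  have h1 : q ≤ a / b := (Nat.le_div_iff_mul_le hb).2 (by rw [mul_comm]; exact lo)
  have h2 : a / b < q + 1 := (Nat.div_lt_iff_lt_mul hb).2 (by rw [add_mul, one_mul, mul_comm q b]; exact hi)
  omega

/-- kernel: two points of one cube differ by less than `L^k ≤ |T_ε|/2` in every coordinate, so the torus coordinate distance is
the plain one and is dominated by `|y₁ − y₂|_T`. [folklore] -/
private theorem natAbs_sub_le_T {k : ℕ} (hk : k ≤ P.m + P.K) {y₁ y₂ : Site P 0} {v' : Site P k} (h1 : blk P k y₁ = v')
    (h2 : blk P k y₂ = v') (i : Fin P.d) :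
    (((((y₂ i).val : ℤ) - ((y₁ i).val : ℤ)).natAbs : ℕ) : ℝ) ≤ T P 0 y₁ y₂ := by
  obtain ⟨lo1, hi1⟩ := cube_bounds hk h1 i
  obtain ⟨lo2, hi2⟩ := cube_bounds hk h2 i
  have hB : P.L ^ k ≤ P.L ^ (P.m + P.K) := Nat.pow_le_pow_right P.L_pos hk
  have hN : Nv P 0 i = 2 * P.L ^ (P.m + P.K) := by
    show P.sitesPerDir 0 = _; unfold Params.sitesPerDir; rw [Nat.sub_zero]
  have habs : |((y₁ i).val : ℤ) - ((y₂ i).val : ℤ)| ≤ ((P.L ^ k : ℕ) : ℤ) := by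
    rw [abs_le]; constructor <;> omega
  have h2B : (2 : ℤ) * ((P.L ^ k : ℕ) : ℤ) ≤ ((2 * P.L ^ (P.m + P.K) : ℕ) : ℤ) := by
    exact_mod_cast Nat.mul_le_mul_left 2 hB
  have hΔ : 2 * |((y₁ i).val : ℤ) - ((y₂ i).val : ℤ)| ≤ (Nv P 0 i : ℤ) := by
    rw [hN]; linarith
  have hc := circAbs_of_centred (Nv_pos P 0 i) hΔ
  have hle := B4Sect5Torus.circAbs_le_tdist (Nv_pos P 0) (toT y₁) (toT y₂) i
  have ex1 : ((toT y₁) i).val = (y₁ i).val := rfl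
  have ex2 : ((toT y₂) i).val = (y₂ i).val := rfl
  rw [ex1, ex2, hc] at hle
  have e : (((((y₂ i).val : ℤ) - ((y₁ i).val : ℤ)).natAbs : ℕ) : ℝ) = ((|((y₁ i).val : ℤ) - ((y₂ i).val : ℤ)| : ℤ) : ℝ) := by
    rw [← Int.cast_natCast (R := ℝ), Int.natCast_natAbs, abs_sub_comm]
  rw [e]; exact hle

/-- kernel: the `ℓ¹` size of the coordinate difference of two fine sites. [folklore] -/
private def l1v (y₁ y₂ : Site P 0) : ℕ := ∑ i, (((y₂ i).val : ℤ) - ((y₁ i).val : ℤ)).natAbs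

/-- kernel: inside one cube `Σ_i|y₂ᵢ − y₁ᵢ| ≤ d·|y₁ − y₂|_T`. [folklore] -/
private theorem l1v_le_T {k : ℕ} (hk : k ≤ P.m + P.K) {y₁ y₂ : Site P 0} {v' : Site P k} (h1 : blk P k y₁ = v')
    (h2 : blk P k y₂ = v') : ((l1v y₁ y₂ : ℕ) : ℝ) ≤ (P.d : ℝ) * T P 0 y₁ y₂ := by
  unfold l1v
  rw [Nat.cast_sum]
  calc ∑ i, (((((y₂ i).val : ℤ) - ((y₁ i).val : ℤ)).natAbs : ℕ) : ℝ) ≤ ∑ _i : Fin P.d, T P 0 y₁ y₂ :=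
        sum_le_sum fun i _ => natAbs_sub_le_T hk h1 h2 i
    _ = (P.d : ℝ) * T P 0 y₁ y₂ := by rw [sum_const, card_univ, Fintype.card_fin, nsmul_eq_mul]

/-- kernel: `(y + e_i)_i = y_i + 1`. [folklore] -/
private theorem shift_apply_self' (y : Site P 0) (i : Fin P.d) : (Site.shift y i) i = y i + 1 := by
  unfold Site.shift; rw [Function.update_self]

/-- kernel: `(y + e_i)_j = y_j` for `j ≠ i`. [folklore] -/
private theorem shift_apply_ne' (y : Site P 0) {i j : Fin P.d} (h : j ≠ i) : (Site.shift y i) j = y j := by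
  unfold Site.shift; rw [Function.update_of_ne h]

/-- kernel: the label of the shifted coordinate, without wrap-around. [folklore] -/
private theorem val_shift_of_lt (y : Site P 0) (i : Fin P.d) (h : (y i).val + 1 < P.sitesPerDir 0) :
    ((Site.shift y i) i).val = (y i).val + 1 := by
  rw [shift_apply_self', ZMod.val_add, ZMod.val_one, Nat.mod_eq_of_lt h]

/-- kernel: `(y − e_i) + e_i = y`. [folklore] -/
private theorem shift_unshift (y : Site P 0) (i : Fin P.d) : Site.shift (Site.unshift y i) i = y := by
  unfold Site.shift Site.unshift
  rw [Function.update_self, Function.update_idem, sub_add_cancel, Function.update_eq_self]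

/-- kernel: the label of `(y − e_i)_i` is `y_i − 1` when `y_i ≥ 1`. [folklore] -/
private theorem val_unshift (y : Site P 0) (i : Fin P.d) (h : 1 ≤ (y i).val) :
    ((Site.unshift y i) i).val + 1 = (y i).val := by
  set z := Site.unshift y i with hz
  have hs : Site.shift z i = y := shift_unshift y i
  have hmod : (y i).val = ((z i).val + 1) % P.sitesPerDir 0 := by
    rw [← hs, shift_apply_self', ZMod.val_add, ZMod.val_one]
  rcases Nat.lt_or_ge ((z i).val + 1) (P.sitesPerDir 0) with hlt | hge
  · rw [hmod, Nat.mod_eq_of_lt hlt]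
  · exfalso
    have hN : (z i).val + 1 = P.sitesPerDir 0 := le_antisymm (ZMod.val_lt (z i)) hge
    rw [hN, Nat.mod_self] at hmod
    omega

/-- kernel: **the path lemma** — on a cube `□(v′)` of `T_η`, nearest-neighbour differences `≤ B` give
`|g(y₂) − g(y₁)| ≤ B·Σ_i|y₂ᵢ − y₁ᵢ|` (telescoping along a staircase that stays in the cube). [folklore] -/
private theorem path_le {k : ℕ} (hk : k ≤ P.m + P.K) (v' : Site P k) (g : Site P 0 → ℝ) {B : ℝ}
    (hstep : ∀ (y : Site P 0) (i : Fin P.d), blk P k y = v' → blk P k (Site.shift y i) = v' →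
      |g (Site.shift y i) - g y| ≤ B) :
    ∀ (n : ℕ) (y₁ y₂ : Site P 0), l1v y₁ y₂ = n → blk P k y₁ = v' → blk P k y₂ = v' → |g y₂ - g y₁| ≤ B * n := by
  intro n
  induction n with
  | zero =>
    intro y₁ y₂ hn _ _
    have h0 : y₂ = y₁ := by
      funext i
      apply ZMod.val_injective
      have := (Finset.sum_eq_zero_iff.1 hn) i (mem_univ i)
      have := Int.natAbs_eq_zero.1 this
      omega
    subst h0
    simp
  | succ n ih =>
    intro y₁ y₂ hn hy₁ hy₂
    -- a coordinate in which `y₁` and `y₂` differ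
    have hex : ∃ i, (y₂ i).val ≠ (y₁ i).val := by
      by_contra hcon
      push Not at hcon
      have : l1v y₁ y₂ = 0 := Finset.sum_eq_zero fun i _ => by rw [hcon i, sub_self]; rfl
      omega
    obtain ⟨i, hi⟩ := hex
    have hsplit : ∀ w₁ w₂ : Site P 0, l1v w₁ w₂ = (((w₂ i).val : ℤ) - ((w₁ i).val : ℤ)).natAbs +
        ∑ j ∈ univ.erase i, (((w₂ j).val : ℤ) - ((w₁ j).val : ℤ)).natAbs := by
      intro w₁ w₂; unfold l1v; rw [← Finset.add_sum_erase _ _ (mem_univ i)]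
    obtain ⟨lo1, hi1⟩ := cube_bounds hk hy₁ i
    obtain ⟨lo2, hi2⟩ := cube_bounds hk hy₂ i
    have hb0 : 0 < P.L ^ k := pow_pos P.L_pos k
    -- one step from `y₁` towards `y₂` in direction `i`: a point `z` of the cube adjacent to `y₁`
    have hstep1 : ∃ z : Site P 0, blk P k z = v' ∧ l1v z y₂ = n ∧ |g z - g y₁| ≤ B := by
      rcases lt_or_gt_of_ne hi with hlt | hgt
      · -- `y₂ᵢ < y₁ᵢ`: step down, `z = y₁ − e_i`
        have hzv := val_unshift y₁ i (by omega)
        have hzj : ∀ j, j ≠ i → (Site.unshift y₁ i) j = y₁ j := fun j hj => by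
          unfold Site.unshift; rw [Function.update_of_ne hj]
        have hzblk : blk P k (Site.unshift y₁ i) = v' := by
          rw [blk_eq_iff hk]
          intro j
          by_cases hj : j = i
          · subst hj
            exact div_eq_of_bounds hb0 (by omega) (by omega)
          · rw [hzj j hj]; exact (blk_eq_iff hk y₁ v').1 hy₁ j
        refine ⟨Site.unshift y₁ i, hzblk, ?_, ?_⟩
        · have e1 := hsplit y₁ y₂
          have e2 := hsplit (Site.unshift y₁ i) y₂
          have hrest : ∑ j ∈ univ.erase i, (((y₂ j).val : ℤ) - (((Site.unshift y₁ i) j).val : ℤ)).natAbs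
              = ∑ j ∈ univ.erase i, (((y₂ j).val : ℤ) - ((y₁ j).val : ℤ)).natAbs := by
            refine sum_congr rfl fun j hj => ?_
            rw [hzj j (mem_erase.1 hj).1]
          rw [e1] at hn
          rw [e2, hrest]
          omega
        · have h := hstep (Site.unshift y₁ i) i hzblk (by rw [shift_unshift]; exact hy₁)
          rw [shift_unshift] at h; rwa [abs_sub_comm] at h
      · -- `y₁ᵢ < y₂ᵢ`: step up, `z = y₁ + e_i`
        have hlt : (y₁ i).val + 1 < P.sitesPerDir 0 := by
          have := ZMod.val_lt (y₂ i); omega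
        have hzv := val_shift_of_lt y₁ i hlt
        have hblk : blk P k (Site.shift y₁ i) = v' := by
          rw [blk_eq_iff hk]
          intro j
          by_cases hj : j = i
          · subst hj
            exact div_eq_of_bounds hb0 (by omega) (by omega)
          · rw [shift_apply_ne' y₁ hj]; exact (blk_eq_iff hk y₁ v').1 hy₁ j
        refine ⟨Site.shift y₁ i, hblk, ?_, hstep y₁ i hy₁ hblk⟩
        have e1 := hsplit y₁ y₂
        have e2 := hsplit (Site.shift y₁ i) y₂
        have hrest : ∑ j ∈ univ.erase i, (((y₂ j).val : ℤ) - (((Site.shift y₁ i) j).val : ℤ)).natAbs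
            = ∑ j ∈ univ.erase i, (((y₂ j).val : ℤ) - ((y₁ j).val : ℤ)).natAbs := by
          refine sum_congr rfl fun j hj => ?_
          rw [shift_apply_ne' y₁ (mem_erase.1 hj).1]
        rw [e1] at hn
        rw [e2, hrest]
        omega
    obtain ⟨z, hz, hl1, hg1⟩ := hstep1
    have hrec := ih z y₂ hl1 hz hy₂
    calc |g y₂ - g y₁| = |(g y₂ - g z) + (g z - g y₁)| := by ring_nf
      _ ≤ |g y₂ - g z| + |g z - g y₁| := abs_add_le _ _
      _ ≤ B * n + B := add_le_add hrec hg1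
      _ = B * ((n + 1 : ℕ) : ℝ) := by push_cast; ring

/-- kernel: the path lemma against the torus distance: `|g(y₂) − g(y₁)| ≤ B·d·|y₁ − y₂|_T` inside a cube. [folklore] -/
private theorem path_le_T {k : ℕ} (hk : k ≤ P.m + P.K) (v' : Site P k) (g : Site P 0 → ℝ) {B : ℝ} (hB : 0 ≤ B)
    (hstep : ∀ (y : Site P 0) (i : Fin P.d), blk P k y = v' → blk P k (Site.shift y i) = v' →
      |g (Site.shift y i) - g y| ≤ B) {y₁ y₂ : Site P 0} (hy₁ : blk P k y₁ = v') (hy₂ : blk P k y₂ = v') :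
    |g y₂ - g y₁| ≤ B * ((P.d : ℝ) * T P 0 y₁ y₂) :=
  (path_le hk v' g hstep (l1v y₁ y₂) y₁ y₂ rfl hy₁ hy₂).trans (mul_le_mul_of_nonneg_left (l1v_le_T hk hy₁ hy₂) hB)

/-! ## §3 The two-variable field `(x,x′) ↦ G_k(T_η,0;x,x′)` on `□(v) × □(v′)`, its lattice derivatives in the `2d` directions of the
product lattice, and the norm (1.32) "extended in a natural way to functions of many variables" -/

section Field

variable (P) (a msq : ℝ) (k : ℕ)

/-- The two-variable field of (3.1) for the torus instance, IN THE PRINT'S UNITS for the step `k` (`η = L^{−k}`): `F(x, x′) =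
G_k(T_η,0;x,x′) = (L^k)^d(L^kε)^{−2}·G^ε_k(x,x′)` — the companions' `ε^d`-normalised kernel `ε^{−d}G^ε_k` rescaled from `T_ε` to `T_η`
(`(L^k)^d(L^kε)^{−2} = (L^kε)^{d−2}·ε^{−d}`: a covariance has scaling dimension `2 − d`); at `k = K` it is `ε^{−d}G^ε_K`. A function on the
PRODUCT lattice `T_η × T_η`; the localization `h ⊗ h′ = 1_{□(v)} ⊗ 1_{□(v′)}` of p. 420 enters through the domain `sites v v′`.
[cite: Balaban1983Higgs3, (3.1) p.432] -/
def kerF (z : Site P 0 × Site P 0) : ℝ :=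
  ((P.L : ℝ) ^ k) ^ P.d * (P.spacing k ^ 2)⁻¹ * (tower P a msq).G k z.1 z.2

/-- The localization domain `□(v) × □(v′)`: pairs of fine sites with `⌊x/L^k⌋ = v`, `⌊x′/L^k⌋ = v′` (unit cubes of `T_1^{(k)}`).
[cite: Balaban1983Higgs3, (3.1) p.432] -/
def sites (v v' : Site P k) : Finset (Site P 0 × Site P 0) :=
  univ.filter fun z => blk P k z.1 = v ∧ blk P k z.2 = v'

/-- Lattice bonds of the product lattice inside `□(v) × □(v′)`, indexed as `(direction, base point)`: a ROW bond `inl (μ, (x,x′))` from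
`(x,x′)` to `(x+e_μ,x′)` (both `x, x+e_μ ∈ □(v)`) or a COLUMN bond `inr (ν, (x,x′))` to `(x,x′+e_ν)` (both `x′, x′+e_ν ∈ □(v′)`) — the
index set of the covariant derivatives `D^η_{B̃,μ}` of (1.32) for a function of the `2d` lattice variables (here `B̃ = 0`).
[cite: Balaban1983Higgs3, (1.32) p.420] -/
def bonds (v v' : Site P k) : Finset ((Fin P.d × (Site P 0 × Site P 0)) ⊕ (Fin P.d × (Site P 0 × Site P 0))) :=
  (univ.filter fun b => b.2 ∈ sites P k v v' ∧ blk P k (Site.shift b.2.1 b.1) = v).disjSum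
  (univ.filter fun b => b.2 ∈ sites P k v v' ∧ blk P k (Site.shift b.2.2 b.1) = v')

/-- The lattice derivatives `∂^η F` along the product-lattice bonds: `η^{−1}(F(x+e_μ,x′) − F(x,x′))` on a row bond,
`η^{−1}(F(x,x′+e_ν) − F(x,x′))` on a column bond (`η^{−1} = L^k`; `U ≡ 1` at `B̃ = 0`). [cite: Balaban1983Higgs3, (1.32) p.420] -/
def derivF : (Fin P.d × (Site P 0 × Site P 0)) ⊕ (Fin P.d × (Site P 0 × Site P 0)) → ℝ :=
  Sum.elim (fun b => (P.L : ℝ) ^ k * (kerF P a msq k (Site.shift b.2.1 b.1, b.2.2) - kerF P a msq k b.2))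
    (fun b => (P.L : ℝ) ^ k * (kerF P a msq k (b.2.1, Site.shift b.2.2 b.1) - kerF P a msq k b.2))

/-- The direction of a bond (one of the `2d` directions of the product lattice). [cite: Balaban1983Higgs3, (1.32) p.420] -/
def dirOf : (Fin P.d × (Site P 0 × Site P 0)) ⊕ (Fin P.d × (Site P 0 × Site P 0)) → Fin P.d ⊕ Fin P.d :=
  Sum.elim (fun b => Sum.inl b.1) (fun b => Sum.inr b.1)

/-- The base point `(x, x′)` of a bond. [cite: Balaban1983Higgs3, (1.32) p.420] -/
def baseOf : (Fin P.d × (Site P 0 × Site P 0)) ⊕ (Fin P.d × (Site P 0 × Site P 0)) → Site P 0 × Site P 0 :=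
  Sum.elim (fun b => b.2) (fun b => b.2)

/-- The sup-distance `|z − z′|` of two points of the product lattice in `η`-units: `η·max(|x − y|_T, |x′ − y′|_T)`, `η = L^{−k}`.
[cite: Balaban1983Higgs3, (1.32) p.420] -/
def pdist (z z' : Site P 0 × Site P 0) : ℝ := max (T P 0 z.1 z'.1) (T P 0 z.2 z'.2) / (P.L : ℝ) ^ k

/-- **‖hG_k(T_η,0)h′‖_{1,α} for the torus instance**: the printed (1.32) SUM form `B3Sect1Statements.norm132` — `sup|F| + sup|∂F| +
sup |∂F(b′) − ∂F(b)|/|z(b) − z(b′)|^α` over same-direction bond pairs — of the two-variable field `F = G_k(T_η,0;·,·)` on the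
localization domain `□(v) × □(v′)`, derivatives in all `2d` directions, transport `U(B̃(Γ)) = id` (`B̃ = 0`).  This is the reading of
«This definition extends in a natural way to functions of many variables» (p. 420) used here. [cite: Balaban1983Higgs3, (3.1) p.432] -/
def normHGH (α : ℝ) (v v' : Site P k) : ℝ :=
  norm132 α (fun c c' => dirOf P c = dirOf P c') (fun c c' => pdist P k (baseOf P c) (baseOf P c')) (fun _ _ => id)
    (sites P k v v') (bonds P k v v') (kerF P a msq k) (derivF P a msq k)

/-- **The concrete carrier of B3 §3 for the TORUS MODEL INSTANCE `A = B̃ = 0`, `Ω = T_η`** at the scale `k` of the volume `P`: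
localization functions `LocFn` = the unit cubes `□(v)` of p. 420 (labelled by `v ∈ T_1^{(k)}`; the propagator's localizing functions
`h, h′` are the indicators of two such cubes), `distCubes = dist(□(v),□(v′))` (`cubeDistT`), `normHGH α h h′ = ‖hG_k(T_η,0)h′‖_{1,α}`;
the data of (3.2)–(3.5) are NOT modelled: `RenClass′ = ∅` (so `Ineq32`, `Ineq33`, `Claim35` are vacuous for this carrier and nothing
is claimed about them), `e(L^kε) = λ(L^kε) = 0`. [cite: Balaban1983Higgs3, (3.1) p.432] -/
def sect3ZeroTorus : Sect3Data where
  eRun := 0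
  lamRun := 0
  LocFn := Site P k
  distCubes := cubeDistT k
  normHGH := fun α v v' => normHGH P a msq k α v v'
  RenClass' := PEmpty
  Loc := fun G => G.elim
  ExtS := PUnit
  ExtV := PUnit
  E' := fun G => G.elim
  E3 := fun G => G.elim
  dv := fun G => G.elim
  ds := fun G => G.elim
  normS := fun _ _ => 0
  normV := fun _ _ => 0
  lhs35 := fun G => G.elim
  GenFamily := fun G => G.elim
  rhs35 := fun G => G.elim
  PosAlongOrderings := fun G => G.elim

/-- `(3.1)` for the carrier unfolds to the bound on `normHGH`. [cite: Balaban1983Higgs3, (3.1) p.432] -/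
theorem ineq31_iff (α δ₀ C : ℝ) :
    (sect3ZeroTorus P a msq k).Ineq31 α δ₀ C ↔
      ∀ v v' : Site P k, 1 ≤ cubeDistT k v v' → normHGH P a msq k α v v' ≤ C * Real.exp (-(δ₀ * cubeDistT k v v')) :=
  Iff.rfl

end Field

/-! ## §4 The three parts of (1.32) for the instance, from kernel clauses at separation `ρ = 1` in the rescaled (`η`-unit) form -/

section Parts

variable {a msq : ℝ} {k : ℕ}

/-- kernel: the exponential at the actual distance is at most the exponential at the cube distance. [folklore] -/
private theorem exp_sep_le {δ q D : ℝ} (hδ : 0 ≤ δ) (h : D ≤ q) : Real.exp (-(δ * q)) ≤ Real.exp (-(δ * D)) :=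
  Real.exp_le_exp.2 (by nlinarith)

/-- **Part 1 of (1.32): `sup_{□(v)×□(v′)} |G_k(T_η,0;x,x′)| ≤ C_V·e^{−δ·dist(□(v),□(v′))}`** from the value clause at separation 1.
[cite: Balaban1983Higgs3, (3.1) p.432] -/
theorem supPart_le (hk : k ≤ P.m + P.K) {δ CV : ℝ} (hδ : 0 ≤ δ) (hCV : 0 ≤ CV)
    (hV : ∀ x x' : Site P 0, 1 * (P.L : ℝ) ^ k ≤ T P 0 x x' →
      |kerF P a msq k (x, x')| ≤ CV * Real.exp (-(δ * (T P 0 x x' / (P.L : ℝ) ^ k))))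
    {v v' : Site P k} (hD : 1 ≤ cubeDistT k v v') :
    LatticeNorms.supNorm (sites P k v v') (kerF P a msq k) ≤ CV * Real.exp (-(δ * cubeDistT k v v')) := by
  refine LatticeNorms.supNorm_le (by positivity) fun z hz => ?_
  obtain ⟨hz1, hz2⟩ := (mem_filter.1 hz).2
  obtain ⟨hsep, hDle⟩ := sep_of_blk hk hz1 hz2 hD
  rw [Real.norm_eq_abs]
  exact (hV z.1 z.2 hsep).trans (mul_le_mul_of_nonneg_left (exp_sep_le hδ hDle) hCV)

/-- **Part 2 of (1.32): `sup_{bonds} |∂^ηF| ≤ (C_D + C_D′)·e^{−δ·dist(□(v),□(v′))}`** from the row/column derivative clauses.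
[cite: Balaban1983Higgs3, (3.1) p.432] -/
theorem derivPart_le (hk : k ≤ P.m + P.K) {δ CD CD' : ℝ} (hδ : 0 ≤ δ) (hCD : 0 ≤ CD) (hCD' : 0 ≤ CD')
    (hDf : ∀ (μ : Fin P.d) (x x' : Site P 0), 1 * (P.L : ℝ) ^ k ≤ T P 0 x x' →
      (P.L : ℝ) ^ k * |kerF P a msq k (Site.shift x μ, x') - kerF P a msq k (x, x')|
        ≤ CD * Real.exp (-(δ * (T P 0 x x' / (P.L : ℝ) ^ k))))
    (hDf' : ∀ (ν : Fin P.d) (x x' : Site P 0), 1 * (P.L : ℝ) ^ k ≤ T P 0 x x' →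
      (P.L : ℝ) ^ k * |kerF P a msq k (x, Site.shift x' ν) - kerF P a msq k (x, x')|
        ≤ CD' * Real.exp (-(δ * (T P 0 x x' / (P.L : ℝ) ^ k))))
    {v v' : Site P k} (hD : 1 ≤ cubeDistT k v v') :
    LatticeNorms.supNorm (bonds P k v v') (derivF P a msq k) ≤ (CD + CD') * Real.exp (-(δ * cubeDistT k v v')) := by
  have hb : (0 : ℝ) ≤ (P.L : ℝ) ^ k := (pow_pos P.cast_L_pos k).le
  have hE : 0 ≤ Real.exp (-(δ * cubeDistT k v v')) := (Real.exp_pos _).le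
  refine LatticeNorms.supNorm_le (by positivity) fun c hc => ?_
  rcases c with b | b
  · -- a row bond `(μ, (x,x′))`
    obtain ⟨hz, -⟩ := (mem_filter.1 (Finset.inl_mem_disjSum.1 hc)).2
    obtain ⟨hz1, hz2⟩ := (mem_filter.1 hz).2
    obtain ⟨hsep, hDle⟩ := sep_of_blk hk hz1 hz2 hD
    have h := hDf b.1 b.2.1 b.2.2 hsep
    simp only [Real.norm_eq_abs, derivF, Sum.elim_inl]
    rw [abs_mul, abs_of_nonneg hb]
    calc _ ≤ CD * Real.exp (-(δ * (T P 0 b.2.1 b.2.2 / (P.L : ℝ) ^ k))) := h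
      _ ≤ CD * Real.exp (-(δ * cubeDistT k v v')) := mul_le_mul_of_nonneg_left (exp_sep_le hδ hDle) hCD
      _ ≤ (CD + CD') * Real.exp (-(δ * cubeDistT k v v')) := by nlinarith
  · -- a column bond `(ν, (x,x′))`
    obtain ⟨hz, -⟩ := (mem_filter.1 (Finset.inr_mem_disjSum.1 hc)).2
    obtain ⟨hz1, hz2⟩ := (mem_filter.1 hz).2
    obtain ⟨hsep, hDle⟩ := sep_of_blk hk hz1 hz2 hD
    have h := hDf' b.1 b.2.1 b.2.2 hsep
    simp only [Real.norm_eq_abs, derivF, Sum.elim_inr]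
    rw [abs_mul, abs_of_nonneg hb]
    calc _ ≤ CD' * Real.exp (-(δ * (T P 0 b.2.1 b.2.2 / (P.L : ℝ) ^ k))) := h
      _ ≤ CD' * Real.exp (-(δ * cubeDistT k v v')) := mul_le_mul_of_nonneg_left (exp_sep_le hδ hDle) hCD'
      _ ≤ (CD + CD') * Real.exp (-(δ * cubeDistT k v v')) := by nlinarith

/-- kernel: `t ≤ t^α` for `0 < t ≤ 1`, `α ≤ 1`. [folklore] -/
private theorem le_rpow_of_le_one {t α : ℝ} (ht0 : 0 < t) (ht1 : t ≤ 1) (hα1 : α ≤ 1) : t ≤ t ^ α := by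
  calc t = t ^ (1 : ℝ) := (Real.rpow_one t).symm
    _ ≤ t ^ α := Real.rpow_le_rpow_of_exponent_ge ht0 ht1 hα1

/-- kernel: distinct fine sites are at torus distance `≥ 1`. [folklore] -/
private theorem one_le_T_of_ne {x x' : Site P 0} (hne : x ≠ x') : 1 ≤ T P 0 x x' := by
  have h0 : T P 0 x x' ≠ 0 := fun h => hne (eq_of_T_eq_zero P h)
  unfold T B4Sect5Torus.tdist at h0 ⊢
  have : (univ.sup (B4Sect5Torus.ccoord (Nv P 0) (toT x) (toT x')) : ℕ) ≠ 0 := by exact_mod_cast h0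
  exact_mod_cast Nat.one_le_iff_ne_zero.2 this

set_option maxHeartbeats 1600000 in
/-- **Part 3 of (1.32): the Hölder quotients of the derivatives of `F = G_k(T_η,0;·,·)` over same-direction bond pairs of
`□(v) × □(v′)` are `≤ C·e^{−δ·dist(□(v),□(v′))}·|z − z′|^α`.**  For two ROW bonds `(μ,(x₁,x₁′))`, `(μ,(x₂,x₂′))` the difference
`∂_μF(x₂,x₂′) − ∂_μF(x₁,x₁′)` is split at `(x₁,x₂′)`: the first half is the Hölder quotient of the row derivative in the row variable
(Hölder clause), the second half is a variation in the COLUMN variable, telescoped along a staircase path inside `□(v′)` with steps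
bounded by the mixed clause when `η|x₂′−x₁′| ≤ 1` (then `t ≤ t^α`), and bounded by twice the derivative sup when `η|x₂′−x₁′| > 1`
(then `1 ≤ t^α`); column bonds symmetrically. [cite: Balaban1983Higgs3, (3.1) p.432] -/
theorem holderPart_le (hk : k ≤ P.m + P.K) {α δ CD CD' CH CH' CM : ℝ} (hα0 : 0 ≤ α) (hα1 : α < 1) (hδ : 0 ≤ δ)
    (hCD : 0 ≤ CD) (hCD' : 0 ≤ CD') (hCH : 0 ≤ CH) (hCH' : 0 ≤ CH') (hCM : 0 ≤ CM)
    (hDf : ∀ (μ : Fin P.d) (x x' : Site P 0), 1 * (P.L : ℝ) ^ k ≤ T P 0 x x' →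
      (P.L : ℝ) ^ k * |kerF P a msq k (Site.shift x μ, x') - kerF P a msq k (x, x')|
        ≤ CD * Real.exp (-(δ * (T P 0 x x' / (P.L : ℝ) ^ k))))
    (hDf' : ∀ (ν : Fin P.d) (x x' : Site P 0), 1 * (P.L : ℝ) ^ k ≤ T P 0 x x' →
      (P.L : ℝ) ^ k * |kerF P a msq k (x, Site.shift x' ν) - kerF P a msq k (x, x')|
        ≤ CD' * Real.exp (-(δ * (T P 0 x x' / (P.L : ℝ) ^ k))))
    (hH : ∀ (μ : Fin P.d) (x₁ x₂ x : Site P 0), x₁ ≠ x₂ → 1 * (P.L : ℝ) ^ k ≤ min (T P 0 x₁ x) (T P 0 x₂ x) →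
      (P.L : ℝ) ^ k * |(kerF P a msq k (Site.shift x₂ μ, x) - kerF P a msq k (x₂, x))
          - (kerF P a msq k (Site.shift x₁ μ, x) - kerF P a msq k (x₁, x))|
        ≤ CH * Real.exp (-(δ * (min (T P 0 x₁ x) (T P 0 x₂ x) / (P.L : ℝ) ^ k))) * (T P 0 x₁ x₂ / (P.L : ℝ) ^ k) ^ α)
    (hH' : ∀ (ν : Fin P.d) (x x₁' x₂' : Site P 0), x₁' ≠ x₂' → 1 * (P.L : ℝ) ^ k ≤ min (T P 0 x x₁') (T P 0 x x₂') →
      (P.L : ℝ) ^ k * |(kerF P a msq k (x, Site.shift x₂' ν) - kerF P a msq k (x, x₂'))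
          - (kerF P a msq k (x, Site.shift x₁' ν) - kerF P a msq k (x, x₁'))|
        ≤ CH' * Real.exp (-(δ * (min (T P 0 x x₁') (T P 0 x x₂') / (P.L : ℝ) ^ k))) * (T P 0 x₁' x₂' / (P.L : ℝ) ^ k) ^ α)
    (hMx : ∀ (μ ν : Fin P.d) (x x' : Site P 0), 1 * (P.L : ℝ) ^ k ≤ T P 0 x x' →
      (P.L : ℝ) ^ k * ((P.L : ℝ) ^ k * |kerF P a msq k (Site.shift x μ, Site.shift x' ν) - kerF P a msq k (Site.shift x μ, x')
          - kerF P a msq k (x, Site.shift x' ν) + kerF P a msq k (x, x')|)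
        ≤ CM * Real.exp (-(δ * (T P 0 x x' / (P.L : ℝ) ^ k))))
    {v v' : Site P k} (hD : 1 ≤ cubeDistT k v v') :
    LatticeNorms.holderSeminorm α (fun c c' => dirOf P c = dirOf P c') (fun c c' => pdist P k (baseOf P c) (baseOf P c'))
        (fun _ _ => id) (bonds P k v v') (derivF P a msq k)
      ≤ ((CH + (P.d : ℝ) * CM + 2 * CD) + (CH' + (P.d : ℝ) * CM + 2 * CD')) * Real.exp (-(δ * cubeDistT k v v')) := by
  have hL : 0 < (P.L : ℝ) ^ k := pow_pos P.cast_L_pos k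
  set E : ℝ := Real.exp (-(δ * cubeDistT k v v')) with hEdef
  have hE : 0 < E := Real.exp_pos _
  have hd0 : (0 : ℝ) ≤ (P.d : ℝ) := Nat.cast_nonneg _
  have hK1 : 0 ≤ CH + (P.d : ℝ) * CM + 2 * CD := by positivity
  have hK2 : 0 ≤ CH' + (P.d : ℝ) * CM + 2 * CD' := by positivity
  -- decay comparisons against the cube distance
  have hEle : ∀ {x x' : Site P 0}, blk P k x = v → blk P k x' = v' →
      Real.exp (-(δ * (T P 0 x x' / (P.L : ℝ) ^ k))) ≤ E := fun hx hx' => exp_sep_le hδ (sep_of_blk hk hx hx' hD).2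
  have hEmin : ∀ {x₁ x₂ x' : Site P 0}, blk P k x₁ = v → blk P k x₂ = v → blk P k x' = v' →
      1 * (P.L : ℝ) ^ k ≤ min (T P 0 x₁ x') (T P 0 x₂ x') ∧ Real.exp (-(δ * (min (T P 0 x₁ x') (T P 0 x₂ x') / (P.L : ℝ) ^ k))) ≤ E := by
    intro x₁ x₂ x' h1 h2 h'
    have s1 := sep_of_blk hk h1 h' hD
    have s2 := sep_of_blk hk h2 h' hD
    refine ⟨le_min s1.1 s2.1, exp_sep_le hδ ?_⟩
    rw [le_div_iff₀ hL]
    have a1 := s1.2; have a2 := s2.2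
    rw [le_div_iff₀ hL] at a1 a2
    exact le_min a1 a2
  have hEmin' : ∀ {x x₁' x₂' : Site P 0}, blk P k x = v → blk P k x₁' = v' → blk P k x₂' = v' →
      1 * (P.L : ℝ) ^ k ≤ min (T P 0 x x₁') (T P 0 x x₂') ∧ Real.exp (-(δ * (min (T P 0 x x₁') (T P 0 x x₂') / (P.L : ℝ) ^ k))) ≤ E := by
    intro x x₁' x₂' h h1 h2
    have s1 := sep_of_blk hk h h1 hD
    have s2 := sep_of_blk hk h h2 hD
    refine ⟨le_min s1.1 s2.1, exp_sep_le hδ ?_⟩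
    rw [le_div_iff₀ hL]
    have a1 := s1.2; have a2 := s2.2
    rw [le_div_iff₀ hL] at a1 a2
    exact le_min a1 a2
  refine LatticeNorms.holderSeminorm_le (by positivity) fun c hc c' hc' hdir hpos => ?_
  rw [Real.norm_eq_abs]
  change |derivF P a msq k c' - derivF P a msq k c|
    ≤ ((CH + (P.d : ℝ) * CM + 2 * CD) + (CH' + (P.d : ℝ) * CM + 2 * CD')) * E
      * (pdist P k (baseOf P c) (baseOf P c')) ^ α
  rcases c with b₁ | b₁ <;> rcases c' with b₂ | b₂
  · ----------------------------------------------------------------- two ROW bonds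
    simp only [dirOf, Sum.elim_inl, Sum.inl.injEq] at hdir
    obtain ⟨hz₁, hbe₁⟩ := (mem_filter.1 (Finset.inl_mem_disjSum.1 hc)).2
    obtain ⟨hz₂, hbe₂⟩ := (mem_filter.1 (Finset.inl_mem_disjSum.1 hc')).2
    obtain ⟨hx₁, hx₁'⟩ := (mem_filter.1 hz₁).2
    obtain ⟨hx₂, hx₂'⟩ := (mem_filter.1 hz₂).2
    obtain ⟨μ₁, x₁, x₁'⟩ := b₁
    obtain ⟨μ₂, x₂, x₂'⟩ := b₂
    simp only at hdir hbe₁ hbe₂ hx₁ hx₁' hx₂ hx₂' ⊢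
    subst hdir
    simp only [baseOf, Sum.elim_inl, derivF, pdist]
    set Q : ℝ := max (T P 0 x₁ x₂) (T P 0 x₁' x₂') / (P.L : ℝ) ^ k with hQdef
    have hQ0 : 0 ≤ Q := div_nonneg (le_trans (T_nonneg P 0 _ _) (le_max_left _ _)) hL.le
    -- T1: same column `x₂′`, rows `x₁ → x₂`
    have T1 : |(P.L : ℝ) ^ k * (kerF P a msq k (Site.shift x₂ μ₁, x₂') - kerF P a msq k (x₂, x₂')) - (P.L : ℝ) ^ k * (kerF P a msq k (Site.shift x₁ μ₁, x₂') - kerF P a msq k (x₁, x₂'))|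
        ≤ CH * E * Q ^ α := by
      by_cases hx : x₁ = x₂
      · subst hx; rw [sub_self, abs_zero]; positivity
      · obtain ⟨hs, hEm⟩ := hEmin hx₁ hx₂ hx₂'
        have h := hH μ₁ x₁ x₂ x₂' hx hs
        rw [← mul_sub, abs_mul, abs_of_pos hL]
        refine h.trans ?_
        have hq : (T P 0 x₁ x₂ / (P.L : ℝ) ^ k) ^ α ≤ Q ^ α :=
          Real.rpow_le_rpow (div_nonneg (T_nonneg P 0 _ _) hL.le)
            (div_le_div_of_nonneg_right (le_max_left _ _) hL.le) hα0
        calc CH * Real.exp (-(δ * (min (T P 0 x₁ x₂') (T P 0 x₂ x₂') / (P.L : ℝ) ^ k))) * (T P 0 x₁ x₂ / (P.L : ℝ) ^ k) ^ α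
            ≤ CH * E * (T P 0 x₁ x₂ / (P.L : ℝ) ^ k) ^ α :=
              mul_le_mul_of_nonneg_right (mul_le_mul_of_nonneg_left hEm hCH) (Real.rpow_nonneg
                (div_nonneg (T_nonneg P 0 _ _) hL.le) _)
          _ ≤ CH * E * Q ^ α := mul_le_mul_of_nonneg_left hq (by positivity)
    -- T2: same row bond at `x₁`, columns `x₁′ → x₂′`
    have T2 : |(P.L : ℝ) ^ k * (kerF P a msq k (Site.shift x₁ μ₁, x₂') - kerF P a msq k (x₁, x₂')) - (P.L : ℝ) ^ k * (kerF P a msq k (Site.shift x₁ μ₁, x₁') - kerF P a msq k (x₁, x₁'))|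
        ≤ ((P.d : ℝ) * CM + 2 * CD) * E * Q ^ α := by
      by_cases hx' : x₁' = x₂'
      · subst hx'; rw [sub_self, abs_zero]; positivity
      · have hs1 : 1 ≤ T P 0 x₁' x₂' := one_le_T_of_ne hx'
        set t : ℝ := T P 0 x₁' x₂' / (P.L : ℝ) ^ k with htdef
        have ht0 : 0 < t := div_pos (lt_of_lt_of_le one_pos hs1) hL
        have htQ : t ≤ Q := div_le_div_of_nonneg_right (le_max_right _ _) hL.le
        have htQα : t ^ α ≤ Q ^ α := Real.rpow_le_rpow ht0.le htQ hα0
        by_cases ht1 : t ≤ 1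
        · -- telescoping in the column variable inside `□(v′)`
          set g : Site P 0 → ℝ := fun y => (P.L : ℝ) ^ k * (kerF P a msq k (Site.shift x₁ μ₁, y) - kerF P a msq k (x₁, y)) with hgdef
          have hstep : ∀ (y : Site P 0) (i : Fin P.d), blk P k y = v' → blk P k (Site.shift y i) = v' →
              |g (Site.shift y i) - g y| ≤ CM * E / (P.L : ℝ) ^ k := by
            intro y i hy _
            have hs := (sep_of_blk hk hx₁ hy hD).1
            have hm := (hMx μ₁ i x₁ y hs).trans (mul_le_mul_of_nonneg_left (hEle hx₁ hy) hCM)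
            rw [le_div_iff₀ hL]
            calc |g (Site.shift y i) - g y| * (P.L : ℝ) ^ k
                = (P.L : ℝ) ^ k * ((P.L : ℝ) ^ k * |kerF P a msq k (Site.shift x₁ μ₁, Site.shift y i) - kerF P a msq k (Site.shift x₁ μ₁, y)
                    - kerF P a msq k (x₁, Site.shift y i) + kerF P a msq k (x₁, y)|) := by
                  simp only [hgdef]
                  rw [← mul_sub, abs_mul, abs_of_pos hL]
                  ring_nf
              _ ≤ CM * E := hm
          have hpath := path_le_T hk v' g (by positivity) hstep hx₁' hx₂'
          calc _ = |g x₂' - g x₁'| := by simp only [hgdef]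
            _ ≤ CM * E / (P.L : ℝ) ^ k * ((P.d : ℝ) * T P 0 x₁' x₂') := hpath
            _ = (P.d : ℝ) * CM * E * t := by rw [htdef]; ring
            _ ≤ (P.d : ℝ) * CM * E * t ^ α :=
                mul_le_mul_of_nonneg_left (le_rpow_of_le_one ht0 ht1 hα1.le) (by positivity)
            _ ≤ ((P.d : ℝ) * CM + 2 * CD) * E * t ^ α := by
                have h01 : 0 ≤ 2 * CD * (E * t ^ α) := by positivity
                nlinarith
            _ ≤ ((P.d : ℝ) * CM + 2 * CD) * E * Q ^ α := mul_le_mul_of_nonneg_left htQα (by positivity)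
        · -- far apart in the column variable: twice the derivative sup
          push Not at ht1
          have h1 := (hDf μ₁ x₁ x₂' (sep_of_blk hk hx₁ hx₂' hD).1).trans
            (mul_le_mul_of_nonneg_left (hEle hx₁ hx₂') hCD)
          have h2 := (hDf μ₁ x₁ x₁' (sep_of_blk hk hx₁ hx₁' hD).1).trans
            (mul_le_mul_of_nonneg_left (hEle hx₁ hx₁') hCD)
          have h1α : 1 ≤ t ^ α := Real.one_le_rpow ht1.le hα0
          calc _ ≤ |(P.L : ℝ) ^ k * (kerF P a msq k (Site.shift x₁ μ₁, x₂') - kerF P a msq k (x₁, x₂'))| + |(P.L : ℝ) ^ k * (kerF P a msq k (Site.shift x₁ μ₁, x₁') - kerF P a msq k (x₁, x₁'))| :=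
                abs_sub _ _
            _ = (P.L : ℝ) ^ k * |kerF P a msq k (Site.shift x₁ μ₁, x₂') - kerF P a msq k (x₁, x₂')| + (P.L : ℝ) ^ k * |kerF P a msq k (Site.shift x₁ μ₁, x₁') - kerF P a msq k (x₁, x₁')| := by
                rw [abs_mul, abs_of_pos hL, abs_mul, abs_of_pos hL]
            _ ≤ CD * E + CD * E := add_le_add h1 h2
            _ = 2 * CD * E * 1 := by ring
            _ ≤ 2 * CD * E * t ^ α := mul_le_mul_of_nonneg_left h1α (by positivity)
            _ ≤ ((P.d : ℝ) * CM + 2 * CD) * E * t ^ α := by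
                have h02 : 0 ≤ (P.d : ℝ) * CM * (E * t ^ α) := by positivity
                nlinarith
            _ ≤ ((P.d : ℝ) * CM + 2 * CD) * E * Q ^ α := mul_le_mul_of_nonneg_left htQα (by positivity)
    calc |(P.L : ℝ) ^ k * (kerF P a msq k (Site.shift x₂ μ₁, x₂') - kerF P a msq k (x₂, x₂')) - (P.L : ℝ) ^ k * (kerF P a msq k (Site.shift x₁ μ₁, x₁') - kerF P a msq k (x₁, x₁'))|
        ≤ |(P.L : ℝ) ^ k * (kerF P a msq k (Site.shift x₂ μ₁, x₂') - kerF P a msq k (x₂, x₂')) - (P.L : ℝ) ^ k * (kerF P a msq k (Site.shift x₁ μ₁, x₂') - kerF P a msq k (x₁, x₂'))|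
          + |(P.L : ℝ) ^ k * (kerF P a msq k (Site.shift x₁ μ₁, x₂') - kerF P a msq k (x₁, x₂')) - (P.L : ℝ) ^ k * (kerF P a msq k (Site.shift x₁ μ₁, x₁') - kerF P a msq k (x₁, x₁'))| :=
          abs_sub_le _ _ _
      _ ≤ CH * E * Q ^ α + ((P.d : ℝ) * CM + 2 * CD) * E * Q ^ α := add_le_add T1 T2
      _ = (CH + (P.d : ℝ) * CM + 2 * CD) * E * Q ^ α := by ring
      _ ≤ _ := by
          have : 0 ≤ E * Q ^ α := by positivity
          nlinarith
  · -- a row bond and a column bond never have the same direction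
    simp [dirOf] at hdir
  · simp [dirOf] at hdir
  · ----------------------------------------------------------------- two COLUMN bonds
    simp only [dirOf, Sum.elim_inr, Sum.inr.injEq] at hdir
    obtain ⟨hz₁, hbe₁⟩ := (mem_filter.1 (Finset.inr_mem_disjSum.1 hc)).2
    obtain ⟨hz₂, hbe₂⟩ := (mem_filter.1 (Finset.inr_mem_disjSum.1 hc')).2
    obtain ⟨hx₁, hx₁'⟩ := (mem_filter.1 hz₁).2
    obtain ⟨hx₂, hx₂'⟩ := (mem_filter.1 hz₂).2
    obtain ⟨ν₁, x₁, x₁'⟩ := b₁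
    obtain ⟨ν₂, x₂, x₂'⟩ := b₂
    simp only at hdir hbe₁ hbe₂ hx₁ hx₁' hx₂ hx₂' ⊢
    subst hdir
    simp only [baseOf, Sum.elim_inr, derivF, pdist]
    set Q : ℝ := max (T P 0 x₁ x₂) (T P 0 x₁' x₂') / (P.L : ℝ) ^ k with hQdef
    have hQ0 : 0 ≤ Q := div_nonneg (le_trans (T_nonneg P 0 _ _) (le_max_left _ _)) hL.le
    -- T1: same row `x₂`, columns `x₁′ → x₂′`
    have T1 : |(P.L : ℝ) ^ k * (kerF P a msq k (x₂, Site.shift x₂' ν₁) - kerF P a msq k (x₂, x₂')) - (P.L : ℝ) ^ k * (kerF P a msq k (x₂, Site.shift x₁' ν₁) - kerF P a msq k (x₂, x₁'))|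
        ≤ CH' * E * Q ^ α := by
      by_cases hx' : x₁' = x₂'
      · subst hx'; rw [sub_self, abs_zero]; positivity
      · obtain ⟨hs, hEm⟩ := hEmin' hx₂ hx₁' hx₂'
        have h := hH' ν₁ x₂ x₁' x₂' hx' hs
        rw [← mul_sub, abs_mul, abs_of_pos hL]
        refine h.trans ?_
        have hq : (T P 0 x₁' x₂' / (P.L : ℝ) ^ k) ^ α ≤ Q ^ α :=
          Real.rpow_le_rpow (div_nonneg (T_nonneg P 0 _ _) hL.le)
            (div_le_div_of_nonneg_right (le_max_right _ _) hL.le) hα0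
        calc CH' * Real.exp (-(δ * (min (T P 0 x₂ x₁') (T P 0 x₂ x₂') / (P.L : ℝ) ^ k))) * (T P 0 x₁' x₂' / (P.L : ℝ) ^ k) ^ α
            ≤ CH' * E * (T P 0 x₁' x₂' / (P.L : ℝ) ^ k) ^ α :=
              mul_le_mul_of_nonneg_right (mul_le_mul_of_nonneg_left hEm hCH') (Real.rpow_nonneg
                (div_nonneg (T_nonneg P 0 _ _) hL.le) _)
          _ ≤ CH' * E * Q ^ α := mul_le_mul_of_nonneg_left hq (by positivity)
    -- T2: same column bond at `x₁′`, rows `x₁ → x₂`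
    have T2 : |(P.L : ℝ) ^ k * (kerF P a msq k (x₂, Site.shift x₁' ν₁) - kerF P a msq k (x₂, x₁')) - (P.L : ℝ) ^ k * (kerF P a msq k (x₁, Site.shift x₁' ν₁) - kerF P a msq k (x₁, x₁'))|
        ≤ ((P.d : ℝ) * CM + 2 * CD') * E * Q ^ α := by
      by_cases hx : x₁ = x₂
      · subst hx; rw [sub_self, abs_zero]; positivity
      · have hs1 : 1 ≤ T P 0 x₁ x₂ := one_le_T_of_ne hx
        set t : ℝ := T P 0 x₁ x₂ / (P.L : ℝ) ^ k with htdef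
        have ht0 : 0 < t := div_pos (lt_of_lt_of_le one_pos hs1) hL
        have htQ : t ≤ Q := div_le_div_of_nonneg_right (le_max_left _ _) hL.le
        have htQα : t ^ α ≤ Q ^ α := Real.rpow_le_rpow ht0.le htQ hα0
        by_cases ht1 : t ≤ 1
        · -- telescoping in the row variable inside `□(v)`
          set g : Site P 0 → ℝ := fun y => (P.L : ℝ) ^ k * (kerF P a msq k (y, Site.shift x₁' ν₁) - kerF P a msq k (y, x₁')) with hgdef
          have hstep : ∀ (y : Site P 0) (i : Fin P.d), blk P k y = v → blk P k (Site.shift y i) = v →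
              |g (Site.shift y i) - g y| ≤ CM * E / (P.L : ℝ) ^ k := by
            intro y i hy _
            have hs := (sep_of_blk hk hy hx₁' hD).1
            have hm := (hMx i ν₁ y x₁' hs).trans (mul_le_mul_of_nonneg_left (hEle hy hx₁') hCM)
            rw [le_div_iff₀ hL]
            calc |g (Site.shift y i) - g y| * (P.L : ℝ) ^ k
                = (P.L : ℝ) ^ k * ((P.L : ℝ) ^ k * |kerF P a msq k (Site.shift y i, Site.shift x₁' ν₁) - kerF P a msq k (Site.shift y i, x₁')
                    - kerF P a msq k (y, Site.shift x₁' ν₁) + kerF P a msq k (y, x₁')|) := by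
                  simp only [hgdef]
                  rw [← mul_sub, abs_mul, abs_of_pos hL]
                  ring_nf
              _ ≤ CM * E := hm
          have hpath := path_le_T hk v g (by positivity) hstep hx₁ hx₂
          calc _ = |g x₂ - g x₁| := by simp only [hgdef]
            _ ≤ CM * E / (P.L : ℝ) ^ k * ((P.d : ℝ) * T P 0 x₁ x₂) := hpath
            _ = (P.d : ℝ) * CM * E * t := by rw [htdef]; ring
            _ ≤ (P.d : ℝ) * CM * E * t ^ α :=
                mul_le_mul_of_nonneg_left (le_rpow_of_le_one ht0 ht1 hα1.le) (by positivity)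
            _ ≤ ((P.d : ℝ) * CM + 2 * CD') * E * t ^ α := by
                have h01 : 0 ≤ 2 * CD' * (E * t ^ α) := by positivity
                nlinarith
            _ ≤ ((P.d : ℝ) * CM + 2 * CD') * E * Q ^ α := mul_le_mul_of_nonneg_left htQα (by positivity)
        · -- far apart in the row variable: twice the derivative sup
          push Not at ht1
          have h1 := (hDf' ν₁ x₂ x₁' (sep_of_blk hk hx₂ hx₁' hD).1).trans
            (mul_le_mul_of_nonneg_left (hEle hx₂ hx₁') hCD')
          have h2 := (hDf' ν₁ x₁ x₁' (sep_of_blk hk hx₁ hx₁' hD).1).trans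
            (mul_le_mul_of_nonneg_left (hEle hx₁ hx₁') hCD')
          have h1α : 1 ≤ t ^ α := Real.one_le_rpow ht1.le hα0
          calc _ ≤ |(P.L : ℝ) ^ k * (kerF P a msq k (x₂, Site.shift x₁' ν₁) - kerF P a msq k (x₂, x₁'))| + |(P.L : ℝ) ^ k * (kerF P a msq k (x₁, Site.shift x₁' ν₁) - kerF P a msq k (x₁, x₁'))| :=
                abs_sub _ _
            _ = (P.L : ℝ) ^ k * |kerF P a msq k (x₂, Site.shift x₁' ν₁) - kerF P a msq k (x₂, x₁')| + (P.L : ℝ) ^ k * |kerF P a msq k (x₁, Site.shift x₁' ν₁) - kerF P a msq k (x₁, x₁')| := by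
                rw [abs_mul, abs_of_pos hL, abs_mul, abs_of_pos hL]
            _ ≤ CD' * E + CD' * E := add_le_add h1 h2
            _ = 2 * CD' * E * 1 := by ring
            _ ≤ 2 * CD' * E * t ^ α := mul_le_mul_of_nonneg_left h1α (by positivity)
            _ ≤ ((P.d : ℝ) * CM + 2 * CD') * E * t ^ α := by
                have h02 : 0 ≤ (P.d : ℝ) * CM * (E * t ^ α) := by positivity
                nlinarith
            _ ≤ ((P.d : ℝ) * CM + 2 * CD') * E * Q ^ α := mul_le_mul_of_nonneg_left htQα (by positivity)
    calc |(P.L : ℝ) ^ k * (kerF P a msq k (x₂, Site.shift x₂' ν₁) - kerF P a msq k (x₂, x₂')) - (P.L : ℝ) ^ k * (kerF P a msq k (x₁, Site.shift x₁' ν₁) - kerF P a msq k (x₁, x₁'))|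
        ≤ |(P.L : ℝ) ^ k * (kerF P a msq k (x₂, Site.shift x₂' ν₁) - kerF P a msq k (x₂, x₂')) - (P.L : ℝ) ^ k * (kerF P a msq k (x₂, Site.shift x₁' ν₁) - kerF P a msq k (x₂, x₁'))|
          + |(P.L : ℝ) ^ k * (kerF P a msq k (x₂, Site.shift x₁' ν₁) - kerF P a msq k (x₂, x₁')) - (P.L : ℝ) ^ k * (kerF P a msq k (x₁, Site.shift x₁' ν₁) - kerF P a msq k (x₁, x₁'))| :=
          abs_sub_le _ _ _
      _ ≤ CH' * E * Q ^ α + ((P.d : ℝ) * CM + 2 * CD') * E * Q ^ α := add_le_add T1 T2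
      _ = (CH' + (P.d : ℝ) * CM + 2 * CD') * E * Q ^ α := by ring
      _ ≤ _ := by
          have : 0 ≤ E * Q ^ α := by positivity
          nlinarith

end Parts

/-! ## §5 The unit conversion `ε`-normalisation ↔ `η`-normalisation and (3.1) DISCHARGED for the torus instance -/

section Units

variable {a msq : ℝ} {k : ℕ}

/-- kernel: `(L^k)^d(L^kε)^{−2} = ((L^kε)²((L^kε)^d)^{−1})^{−1}·ε^{−d}` — the value weight of file 1 is absorbed. [folklore] -/
private theorem unit_value (k : ℕ) :
    ((P.L : ℝ) ^ k) ^ P.d * (P.spacing k ^ 2)⁻¹ = (P.spacing k ^ 2 * (P.spacing k ^ P.d)⁻¹)⁻¹ * (P.eps ^ P.d)⁻¹ := by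
  have hε := P.eps_pos.ne'
  have hs := (P.spacing_pos k).ne'
  have hb : (P.L : ℝ) ^ k ≠ 0 := (pow_pos P.cast_L_pos k).ne'
  unfold Params.spacing at hs ⊢
  simp only [mul_pow]
  field_simp

/-- kernel: `L^k·(L^k)^d(L^kε)^{−2}·|Δ| = ((L^kε)((L^kε)^d)^{−1})^{−1}·ε^{−d}·ε^{−1}|Δ|` — the derivative weight is absorbed. [folklore] -/
private theorem unit_deriv (k : ℕ) (X : ℝ) :
    (P.L : ℝ) ^ k * (((P.L : ℝ) ^ k) ^ P.d * (P.spacing k ^ 2)⁻¹ * X)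
      = (P.spacing k * (P.spacing k ^ P.d)⁻¹)⁻¹ * ((P.eps ^ P.d)⁻¹ * (P.eps⁻¹ * X)) := by
  have hε := P.eps_pos.ne'
  have hs := (P.spacing_pos k).ne'
  have hb : (P.L : ℝ) ^ k ≠ 0 := (pow_pos P.cast_L_pos k).ne'
  unfold Params.spacing at hs ⊢
  simp only [mul_pow]
  field_simp

/-- kernel: `L^k·L^k·(L^k)^d(L^kε)^{−2}·|M| = (((L^kε)^d)^{−1})^{−1}·ε^{−d}·ε^{−2}|M|` — the mixed weight is absorbed. [folklore] -/
private theorem unit_mixed (k : ℕ) (X : ℝ) :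
    (P.L : ℝ) ^ k * ((P.L : ℝ) ^ k * (((P.L : ℝ) ^ k) ^ P.d * (P.spacing k ^ 2)⁻¹ * X))
      = ((P.spacing k ^ P.d)⁻¹)⁻¹ * ((P.eps ^ P.d)⁻¹ * (P.eps⁻¹ * P.eps⁻¹ * X)) := by
  have hε := P.eps_pos.ne'
  have hs := (P.spacing_pos k).ne'
  have hb : (P.L : ℝ) ^ k ≠ 0 := (pow_pos P.cast_L_pos k).ne'
  unfold Params.spacing at hs ⊢
  simp only [mul_pow]
  field_simp

/-- kernel: the Hölder weight `|x₁−x₂|^α` in `η`-units against `ε`-units: `(|x₁−x₂|_T/L^k)^α = (ε|x₁−x₂|_T)^α·((L^kε)^α)^{−1}`. [folklore] -/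
private theorem unit_dist_rpow (k : ℕ) (α t : ℝ) (ht : 0 ≤ t) :
    (t / (P.L : ℝ) ^ k) ^ α = (P.eps * t) ^ α * (P.spacing k ^ α)⁻¹ := by
  have hε := P.eps_pos
  have hb : 0 < (P.L : ℝ) ^ k := pow_pos P.cast_L_pos k
  have e : t / (P.L : ℝ) ^ k = (P.eps * t) / P.spacing k := by
    unfold Params.spacing; field_simp
  rw [e, Real.div_rpow (mul_nonneg hε.le ht) (P.spacing_pos k).le, div_eq_mul_inv]

end Units

set_option maxHeartbeats 800000 in
/-- **B3 (3.1) p. 432 [PDF 22] — `‖hG_k(Ω,B̃)h′‖_{1,α} ≤ O(1)e^{−δ₀dist(□(v),□(v′))}` — PROVED for the TORUS MODEL INSTANCE `A = B̃ = 0`,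
`Ω = T_η` (the paper's lattice, `η = L^{−k}`), `h, h′` the unit-cube localizations of p. 420, `‖·‖_{1,α}` the printed (1.32) of the
two-variable field:** for `d ≥ 1`, odd `L > 1`, `a > 0`, `m² ≥ 0` and every `0 ≤ α < 1` there are `δ₀ = δ₀(α) > 0`, `C = C(α) > 0`
(depending on `d, L, a, m²` and `α` — the print's O(1) depends on the fixed `α` through Proposition I.2.1, «c₀ on α also») such that
for EVERY volume `P = (d, L, m, K)` of Bałaban's scalar torus tower and every scale `1 ≤ k ≤ K` the typed statement
`(sect3ZeroTorus P a msq k).Ineq31 α δ₀ C` holds, i.e. for all unit cubes `□(v), □(v′)` of `T_1^{(k)}` with `dist(□(v),□(v′)) ≥ 1`: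
`‖1_{□(v)}G_k(T_η,0)1_{□(v′)}‖_{1,α} ≤ C·e^{−δ₀·dist(□(v),□(v′))}`.  Print: *"Such a possibility is assured by the following estimates
‖hG_k(Ω,B̃)h′‖_{1,α} ≤ O(1)e^{−δ₀dist(□(v),□(v′))}, (3.1) and similarly for the vector field propagator, h, h′ are localization
functions."*  Route: the three parts of (1.32) (`supPart_le`, `derivPart_le`, `holderPart_le`) fed with the six kernel clauses of
`B3GkZeroTorusSeparated` at separation `ρ = 1`, converted to the print's units, at the common rate `δ₀ = min δᵢ`.
[cite: Balaban1983Higgs3, (3.1) p.432] -/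
theorem ineq31_zeroTorus (d L : ℕ) (hd : 1 ≤ d) (hL : Odd L ∧ 1 < L) {a : ℝ} (ha : 0 < a) {msq : ℝ} (hmsq : 0 ≤ msq)
    {α : ℝ} (hα0 : 0 ≤ α) (hα1 : α < 1) :
    ∃ δ₀ C : ℝ, 0 < δ₀ ∧ 0 < C ∧ ∀ (P : Params), P.d = d → P.L = L →
      ∀ k : ℕ, 1 ≤ k → k ≤ P.K → (sect3ZeroTorus P a msq k).Ineq31 α δ₀ C := by
  obtain ⟨δ1, CV, hδ1, hCV, hV⟩ := abs_Gk_sep_le d L hd hL ha hmsq one_pos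
  obtain ⟨δ2, CD, hδ2, hCD, hDf⟩ := abs_GkDiff_sep_le d L hd hL ha hmsq one_pos
  obtain ⟨δ3, CD', hδ3, hCD', hDf'⟩ := abs_GkDiff'_sep_le d L hd hL ha hmsq one_pos
  obtain ⟨δ4, CH, hδ4, hCH, hH⟩ := abs_GkDD_sep_le d L hd hL ha hmsq hα0 hα1 one_pos
  obtain ⟨δ5, CH', hδ5, hCH', hH'⟩ := abs_GkDD'_sep_le d L hd hL ha hmsq hα0 hα1 one_pos
  obtain ⟨δ6, CM, hδ6, hCM, hMx⟩ := abs_GkMixed_sep_le d L hd hL ha hmsq one_pos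
  set δ₀ : ℝ := min (min (min δ1 δ2) (min δ3 δ4)) (min δ5 δ6) with hδ₀def
  have hδ₀ : 0 < δ₀ := lt_min (lt_min (lt_min hδ1 hδ2) (lt_min hδ3 hδ4)) (lt_min hδ5 hδ6)
  have l12 : δ₀ ≤ min δ1 δ2 := (min_le_left _ _).trans (min_le_left _ _)
  have l34 : δ₀ ≤ min δ3 δ4 := (min_le_left _ _).trans (min_le_right _ _)
  have l56 : δ₀ ≤ min δ5 δ6 := min_le_right _ _
  have l1 : δ₀ ≤ δ1 := l12.trans (min_le_left _ _)
  have l2 : δ₀ ≤ δ2 := l12.trans (min_le_right _ _)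
  have l3 : δ₀ ≤ δ3 := l34.trans (min_le_left _ _)
  have l4 : δ₀ ≤ δ4 := l34.trans (min_le_right _ _)
  have l5 : δ₀ ≤ δ5 := l56.trans (min_le_left _ _)
  have l6 : δ₀ ≤ δ6 := l56.trans (min_le_right _ _)
  have hd0 : (0 : ℝ) ≤ (d : ℝ) := Nat.cast_nonneg _
  refine ⟨δ₀, CV + (CD + CD') + ((CH + (d : ℝ) * CM + 2 * CD) + (CH' + (d : ℝ) * CM + 2 * CD')), hδ₀, by positivity, ?_⟩
  intro P hPd hPL k hk1 hkK
  have hVP := hV P hPd hPL k hk1 hkK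
  have hDfP := hDf P hPd hPL k hk1 hkK
  have hDf'P := hDf' P hPd hPL k hk1 hkK
  have hHP := hH P hPd hPL k hk1 hkK
  have hH'P := hH' P hPd hPL k hk1 hkK
  have hMxP := hMx P hPd hPL k hk1 hkK
  subst hPd
  have hkm : k ≤ P.m + P.K := hkK.trans (Nat.le_add_left _ _)
  rw [ineq31_iff]
  intro v v' hD
  have hb : (0 : ℝ) < (P.L : ℝ) ^ k := pow_pos P.cast_L_pos k
  have hε := P.eps_pos
  have hsp := P.spacing_pos k
  have hq : ∀ t : ℝ, 0 ≤ t → 0 ≤ t / (P.L : ℝ) ^ k := fun t ht => div_nonneg ht hb.le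
  have hw2 : 0 < P.spacing k ^ 2 * (P.spacing k ^ P.d)⁻¹ := by positivity
  have hw1 : 0 < P.spacing k * (P.spacing k ^ P.d)⁻¹ := by positivity
  have hwα : 0 < P.spacing k * (P.spacing k ^ P.d)⁻¹ * (P.spacing k ^ α)⁻¹ := by
    have := Real.rpow_pos_of_pos hsp α; positivity
  have hw0 : 0 < (P.spacing k ^ P.d)⁻¹ := by positivity
  -- the six clauses in the rescaled (`η`-unit) form, at the common rate `δ₀`
  have cV : ∀ x x' : Site P 0, 1 * (P.L : ℝ) ^ k ≤ T P 0 x x' →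
      |kerF P a msq k (x, x')| ≤ CV * Real.exp (-(δ₀ * (T P 0 x x' / (P.L : ℝ) ^ k))) := by
    intro x x' hs
    have h := (hVP x x' hs).trans (mul_le_mul_of_nonneg_left
      (B4Thm110ZeroBoxDeriv.exp_rate_mono l1 (hq _ (T_nonneg P 0 x x'))) (mul_nonneg hCV.le hw2.le))
    simp only [kerF]
    rw [abs_mul, abs_of_nonneg (by positivity), unit_value, mul_assoc, ← div_eq_inv_mul, div_le_iff₀ hw2]
    calc (P.eps ^ P.d)⁻¹ * |(tower P a msq).G k x x'| ≤ _ := h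
      _ = CV * Real.exp (-(δ₀ * (T P 0 x x' / (P.L : ℝ) ^ k))) * (P.spacing k ^ 2 * (P.spacing k ^ P.d)⁻¹) := by ring
  have cD : ∀ (μ : Fin P.d) (x x' : Site P 0), 1 * (P.L : ℝ) ^ k ≤ T P 0 x x' →
      (P.L : ℝ) ^ k * |kerF P a msq k (Site.shift x μ, x') - kerF P a msq k (x, x')|
        ≤ CD * Real.exp (-(δ₀ * (T P 0 x x' / (P.L : ℝ) ^ k))) := by
    intro μ x x' hs
    have h := (hDfP μ x x' hs).trans (mul_le_mul_of_nonneg_left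
      (B4Thm110ZeroBoxDeriv.exp_rate_mono l2 (hq _ (T_nonneg P 0 x x'))) (mul_nonneg hCD.le hw1.le))
    simp only [kerF]
    rw [← mul_sub, abs_mul, abs_of_nonneg (by positivity), unit_deriv, ← div_eq_inv_mul, div_le_iff₀ hw1]
    calc (P.eps ^ P.d)⁻¹ * (P.eps⁻¹ * |(tower P a msq).G k (Site.shift x μ) x' - (tower P a msq).G k x x'|) ≤ _ := h
      _ = CD * Real.exp (-(δ₀ * (T P 0 x x' / (P.L : ℝ) ^ k))) * (P.spacing k * (P.spacing k ^ P.d)⁻¹) := by ring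
  have cD' : ∀ (ν : Fin P.d) (x x' : Site P 0), 1 * (P.L : ℝ) ^ k ≤ T P 0 x x' →
      (P.L : ℝ) ^ k * |kerF P a msq k (x, Site.shift x' ν) - kerF P a msq k (x, x')|
        ≤ CD' * Real.exp (-(δ₀ * (T P 0 x x' / (P.L : ℝ) ^ k))) := by
    intro ν x x' hs
    have h := (hDf'P ν x x' hs).trans (mul_le_mul_of_nonneg_left
      (B4Thm110ZeroBoxDeriv.exp_rate_mono l3 (hq _ (T_nonneg P 0 x x'))) (mul_nonneg hCD'.le hw1.le))
    simp only [kerF]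
    rw [← mul_sub, abs_mul, abs_of_nonneg (by positivity), unit_deriv, ← div_eq_inv_mul, div_le_iff₀ hw1]
    calc (P.eps ^ P.d)⁻¹ * (P.eps⁻¹ * |(tower P a msq).G k x (Site.shift x' ν) - (tower P a msq).G k x x'|) ≤ _ := h
      _ = CD' * Real.exp (-(δ₀ * (T P 0 x x' / (P.L : ℝ) ^ k))) * (P.spacing k * (P.spacing k ^ P.d)⁻¹) := by ring
  have cH : ∀ (μ : Fin P.d) (x₁ x₂ x : Site P 0), x₁ ≠ x₂ → 1 * (P.L : ℝ) ^ k ≤ min (T P 0 x₁ x) (T P 0 x₂ x) →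
      (P.L : ℝ) ^ k * |(kerF P a msq k (Site.shift x₂ μ, x) - kerF P a msq k (x₂, x))
          - (kerF P a msq k (Site.shift x₁ μ, x) - kerF P a msq k (x₁, x))|
        ≤ CH * Real.exp (-(δ₀ * (min (T P 0 x₁ x) (T P 0 x₂ x) / (P.L : ℝ) ^ k)))
          * (T P 0 x₁ x₂ / (P.L : ℝ) ^ k) ^ α := by
    intro μ x₁ x₂ x hne hs
    have hm0 : 0 ≤ min (T P 0 x₁ x) (T P 0 x₂ x) := le_min (T_nonneg P 0 _ _) (T_nonneg P 0 _ _)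
    have hT12 : 0 < T P 0 x₁ x₂ := lt_of_lt_of_le one_pos (one_le_T_of_ne hne)
    have hwt : 0 < (P.eps * T P 0 x₁ x₂) ^ α := Real.rpow_pos_of_pos (mul_pos hε hT12) α
    have h := (hHP μ x₁ x₂ x hne hs).trans (mul_le_mul_of_nonneg_left
      (B4Thm110ZeroBoxDeriv.exp_rate_mono l4 (hq _ hm0)) (mul_nonneg hCH.le hwα.le))
    rw [div_le_iff₀ hwt] at h
    simp only [kerF]
    rw [← mul_sub, ← mul_sub, ← mul_sub, abs_mul, abs_of_nonneg (by positivity), unit_deriv,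
      unit_dist_rpow k α _ hT12.le, ← div_eq_inv_mul, div_le_iff₀ hw1]
    calc (P.eps ^ P.d)⁻¹ * (P.eps⁻¹ * |((tower P a msq).G k (Site.shift x₂ μ) x - (tower P a msq).G k x₂ x)
            - ((tower P a msq).G k (Site.shift x₁ μ) x - (tower P a msq).G k x₁ x)|) ≤ _ := h
      _ = CH * Real.exp (-(δ₀ * (min (T P 0 x₁ x) (T P 0 x₂ x) / (P.L : ℝ) ^ k)))
            * ((P.eps * T P 0 x₁ x₂) ^ α * (P.spacing k ^ α)⁻¹) * (P.spacing k * (P.spacing k ^ P.d)⁻¹) := by ring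
  have cH' : ∀ (ν : Fin P.d) (x x₁' x₂' : Site P 0), x₁' ≠ x₂' → 1 * (P.L : ℝ) ^ k ≤ min (T P 0 x x₁') (T P 0 x x₂') →
      (P.L : ℝ) ^ k * |(kerF P a msq k (x, Site.shift x₂' ν) - kerF P a msq k (x, x₂'))
          - (kerF P a msq k (x, Site.shift x₁' ν) - kerF P a msq k (x, x₁'))|
        ≤ CH' * Real.exp (-(δ₀ * (min (T P 0 x x₁') (T P 0 x x₂') / (P.L : ℝ) ^ k)))
          * (T P 0 x₁' x₂' / (P.L : ℝ) ^ k) ^ α := by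
    intro ν x x₁' x₂' hne hs
    have hm0 : 0 ≤ min (T P 0 x x₁') (T P 0 x x₂') := le_min (T_nonneg P 0 _ _) (T_nonneg P 0 _ _)
    have hT12 : 0 < T P 0 x₁' x₂' := lt_of_lt_of_le one_pos (one_le_T_of_ne hne)
    have hwt : 0 < (P.eps * T P 0 x₁' x₂') ^ α := Real.rpow_pos_of_pos (mul_pos hε hT12) α
    have h := (hH'P ν x x₁' x₂' hne hs).trans (mul_le_mul_of_nonneg_left
      (B4Thm110ZeroBoxDeriv.exp_rate_mono l5 (hq _ hm0)) (mul_nonneg hCH'.le hwα.le))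
    rw [div_le_iff₀ hwt] at h
    simp only [kerF]
    rw [← mul_sub, ← mul_sub, ← mul_sub, abs_mul, abs_of_nonneg (by positivity), unit_deriv,
      unit_dist_rpow k α _ hT12.le, ← div_eq_inv_mul, div_le_iff₀ hw1]
    calc (P.eps ^ P.d)⁻¹ * (P.eps⁻¹ * |((tower P a msq).G k x (Site.shift x₂' ν) - (tower P a msq).G k x x₂')
            - ((tower P a msq).G k x (Site.shift x₁' ν) - (tower P a msq).G k x x₁')|) ≤ _ := h
      _ = CH' * Real.exp (-(δ₀ * (min (T P 0 x x₁') (T P 0 x x₂') / (P.L : ℝ) ^ k)))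
            * ((P.eps * T P 0 x₁' x₂') ^ α * (P.spacing k ^ α)⁻¹) * (P.spacing k * (P.spacing k ^ P.d)⁻¹) := by ring
  have cM : ∀ (μ ν : Fin P.d) (x x' : Site P 0), 1 * (P.L : ℝ) ^ k ≤ T P 0 x x' →
      (P.L : ℝ) ^ k * ((P.L : ℝ) ^ k * |kerF P a msq k (Site.shift x μ, Site.shift x' ν) - kerF P a msq k (Site.shift x μ, x')
          - kerF P a msq k (x, Site.shift x' ν) + kerF P a msq k (x, x')|)
        ≤ CM * Real.exp (-(δ₀ * (T P 0 x x' / (P.L : ℝ) ^ k))) := by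
    intro μ ν x x' hs
    have h := (hMxP μ ν x x' hs).trans (mul_le_mul_of_nonneg_left
      (B4Thm110ZeroBoxDeriv.exp_rate_mono l6 (hq _ (T_nonneg P 0 x x'))) (mul_nonneg hCM.le hw0.le))
    simp only [kerF]
    rw [show ∀ (c p q r s : ℝ), c * p - c * q - c * r + c * s = c * (p - q - r + s) from fun c p q r s => by ring,
      abs_mul, abs_of_nonneg (by positivity), unit_mixed, ← div_eq_inv_mul, div_le_iff₀ hw0]
    calc (P.eps ^ P.d)⁻¹ * (P.eps⁻¹ * P.eps⁻¹ * |(tower P a msq).G k (Site.shift x μ) (Site.shift x' ν)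
            - (tower P a msq).G k (Site.shift x μ) x' - (tower P a msq).G k x (Site.shift x' ν) + (tower P a msq).G k x x'|)
          ≤ _ := h
      _ = CM * Real.exp (-(δ₀ * (T P 0 x x' / (P.L : ℝ) ^ k))) * (P.spacing k ^ P.d)⁻¹ := by ring
  have P1 := supPart_le (a := a) (msq := msq) hkm hδ₀.le hCV.le cV hD
  have P2 := derivPart_le (a := a) (msq := msq) hkm hδ₀.le hCD.le hCD'.le cD cD' hD
  have P3 := holderPart_le (a := a) (msq := msq) hkm hα0 hα1 hδ₀.le hCD.le hCD'.le hCH.le hCH'.le hCM.le cD cD' cH cH' cM hD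
  show normHGH P a msq k α v v' ≤ _
  unfold normHGH norm132
  calc _ ≤ CV * Real.exp (-(δ₀ * cubeDistT k v v')) + (CD + CD') * Real.exp (-(δ₀ * cubeDistT k v v'))
        + ((CH + (P.d : ℝ) * CM + 2 * CD) + (CH' + (P.d : ℝ) * CM + 2 * CD')) * Real.exp (-(δ₀ * cubeDistT k v v')) :=
        add_le_add (add_le_add P1 P2) P3
    _ = _ := by ring

/-! ## §6 Non-vacuity: the binders are inhabited (`d = 3`, `L = 3`, `a = 1`, `m² = 0`, `α = 1/2`; the volume `m = K = 1`, scale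
`k = 1`: `T_1^{(1)}` has `2·3 = 6` unit cubes per direction, so pairs of cubes at distance `≥ 1` exist and `Ineq31` is a genuine
family of real inequalities) -/

/-- The constants of `ineq31_zeroTorus` exist and (3.1) holds at `α = 1/2` for an explicit torus volume.
[cite: Balaban1983Higgs3, (3.1) p.432] -/
theorem ineq31_zeroTorus_witness :
    ∃ δ₀ C : ℝ, 0 < δ₀ ∧ 0 < C ∧
      (sect3ZeroTorus (⟨3, 3, 1, 1, by norm_num, ⟨⟨1, by norm_num⟩, by norm_num⟩⟩ : Params) 1 0 1).Ineq31 (1 / 2) δ₀ C := by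
  obtain ⟨δ₀, C, hδ₀, hC, h⟩ := ineq31_zeroTorus 3 3 (by norm_num) ⟨⟨1, by norm_num⟩, by norm_num⟩ (a := 1) one_pos
    (msq := 0) le_rfl (α := 1 / 2) (by norm_num) (by norm_num)
  exact ⟨δ₀, C, hδ₀, hC, h _ rfl rfl 1 le_rfl le_rfl⟩

end

end Literature.MathematicalPhysics.QuantumFieldTheory.Balaban1983to89.B3Ineq31ZeroTorus
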